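import Summits.QuantumFields.YangMills.Theorems.LuscherReductionDressedRitzPolyakovLiftPScalingClusters
import Summits.QuantumFields.YangMills.Theorems.LuscherReductionOneSiteLevelsKacDefs
import HarnessLib

/-!
# Route `LuscherReduction`, item `DressedRitz` (stmt-QuantumFields-20205), line «polyakovlift», stub S-PSCAL″ — FAMILY BOOKKEEPING (F9 layer D1c;
# LEAD prover ym-lead-20205-polyakovlift g2)

Two small pieces of index bookkeeping for the assembly of `PScalingExistsForL`:

* `isEigenFamily_castLE` — the restriction of an AL1 eigenfamily `F_0, …, F_K` to its first `k+1` members (`k ≤ K`) is an AL1 eigenfamily (so the witness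
  family of the `∃ g` in S-PSCAL″ is cut from a family running up to a CLUSTER END `K ≥ k`, `PScal.exists_clusterEnd`);
* `card_filter_winLo_lt` / `card_filter_winLo_le` — with the cluster label `cl j := winLo j` on `Fin (K+1)`, `K` a cluster end: `#{j′ | cl j′ < cl j} = winLo j`
  and `#{j′ | cl j′ ≤ cl j} = winHi j` (the `lo`/`le` of `ClusterConc.cluster_concentration_in`), and `winLo_mono_fin` (the label is monotone).

HONEST FRAMING: bookkeeping; nothing here bears on infinite volume, the continuum limit or the Clay gap.
References: Reed–Simon IV, Thm. XIII.1 and XIII.64 [cite: ReedSimonIV1978, Thm. XIII.1].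
-/

set_option autoImplicit false

noncomputable section

open Finset
open scoped BigOperators

namespace Summit.QuantumFields.YangMills.Theorems.FemtoTransferGap.PScal

open Summit.QuantumFields.YangMills.Theorems.FemtoTransferGap
open Literature.Analysis.OperatorTheory.YMMatrixModel

/-! ## §1 Restricting an eigenfamily -/

/-- The first `k+1` members of an AL1 eigenfamily of length `K+1 ≥ k+1` form an AL1 eigenfamily. [cite: ReedSimonIV1978, Thm. XIII.64] -/
theorem isEigenFamily_castLE {K k : ℕ} (hk : k ≤ K) {F : Fin (K + 1) → ZM → ℝ} (hF : IsEigenFamily K F) :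
    IsEigenFamily k (fun j => F (Fin.castLE (Nat.succ_le_succ hk) j)) := by
  obtain ⟨h1, h2, h3, h4, h5⟩ := hF
  refine ⟨fun j => h1 _, fun j => h2 _, fun i j => ?_, fun j x => ?_, fun j => h5 _⟩
  · rw [h3]
    by_cases hij : i = j
    · subst hij; simp
    · have : Fin.castLE (Nat.succ_le_succ hk) i ≠ Fin.castLE (Nat.succ_le_succ hk) j := fun h =>
        hij (Fin.castLE_injective _ h)
      simp [hij, this]
  · rw [h4]; simp

/-- The restricted family has the same ground state. [folklore] -/
theorem castLE_zero {K k : ℕ} (hk : k ≤ K) (F : Fin (K + 1) → ZM → ℝ) :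
    (fun j : Fin (k + 1) => F (Fin.castLE (Nat.succ_le_succ hk) j)) 0 = F 0 := rfl

/-- Member `i.succ` of the restricted family is member `i+1` of the big one. [folklore] -/
theorem castLE_succ_val {K k : ℕ} (hk : k ≤ K) (i : Fin k) :
    ((Fin.castLE (Nat.succ_le_succ hk) i.succ : Fin (K + 1)) : ℕ) = (i : ℕ) + 1 := by simp

/-! ## §2 The cluster label on `Fin (K+1)` -/

/-- The label `j ↦ winLo j` is monotone on `Fin M`. [folklore] -/
theorem winLo_mono_fin (M : ℕ) : Monotone fun j : Fin M => winLo j := fun _ _ h => winLo_mono h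

/-- `#{j′ : Fin (K+1) | winLo j′ < winLo j} = winLo j`. [folklore] -/
theorem card_filter_winLo_lt {K : ℕ} (j : Fin (K + 1)) :
    (univ.filter fun j' : Fin (K + 1) => winLo j' < winLo j).card = winLo j := by
  have hm : winLo j ≤ K + 1 := (winLo_le j).trans j.is_lt.le
  have h : (univ.filter fun j' : Fin (K + 1) => winLo j' < winLo j) =
      (Finset.range (winLo j)).attachFin (fun n hn => lt_of_lt_of_le (mem_range.1 hn) hm) := by
    ext j'; simp [winLo_lt_winLo_iff_lt]
  rw [h, Finset.card_attachFin, Finset.card_range]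

/-- `#{j′ : Fin (K+1) | winLo j′ ≤ winLo j} = winHi j` when `K` is a cluster end. [folklore] -/
theorem card_filter_winLo_le {K : ℕ} (hK : idxLevel K < idxLevel (K + 1)) (j : Fin (K + 1)) :
    (univ.filter fun j' : Fin (K + 1) => winLo j' ≤ winLo j).card = winHi j := by
  have hm : winHi j ≤ K + 1 := winHi_le_of_clusterEnd hK (Nat.le_of_lt_succ j.is_lt)
  have h : (univ.filter fun j' : Fin (K + 1) => winLo j' ≤ winLo j) =
      (Finset.range (winHi j)).attachFin (fun n hn => lt_of_lt_of_le (mem_range.1 hn) hm) := by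
    ext j'; simp [winLo_le_winLo_iff_lt]
  rw [h, Finset.card_attachFin, Finset.card_range]

/-- The window of `j ≤ K` (`K` a cluster end) in numbers: `winLo j ≤ j < winHi j ≤ K+1`, and `1 ≤ winLo j` for `j ≥ 1`. [folklore] -/
theorem window_bounds {K : ℕ} (hK : idxLevel K < idxLevel (K + 1)) (j : Fin (K + 1)) :
    winLo j ≤ (j : ℕ) ∧ (j : ℕ) < winHi j ∧ winHi j ≤ K + 1 ∧ (1 ≤ (j : ℕ) → 1 ≤ winLo j) :=
  ⟨winLo_le j, lt_winHi j, winHi_le_of_clusterEnd hK (Nat.le_of_lt_succ j.is_lt), fun h => one_le_winLo h⟩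

end Summit.QuantumFields.YangMills.Theorems.FemtoTransferGap.PScal

end
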